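/-
Copyright: b2b-lace packet (LEAN TYPING SEAT 1, gen 34). Coordinate-permutation symmetry of the
twisted moments of [FvdH17-NoBLE] (3.34)–(3.36) and the composition-grouped multinomial reduction of
`D̂^l`-weighted twisted seeds. A d-generic, number-free bookkeeping module of the what-if /
input-certification lane: nothing here is a certificate and no dimension-specific sentence is made.
-/
import Literature.Probability.FitznerVanDerHofstad2017.SrwIntegralB3Transport
import Literature.Probability.FitznerVanDerHofstad2017.SrwTwistProductWeight
import HarnessLib

/-!
# Coordinate-permutation symmetry of twisted moments; grouping `D̂^l`-seeds by composition type

The TWISTED MOMENT `Tw^w_n(x;β) = ∫_{[-π,π]^d} w(k) cos(β D̂^{(x)}(k)) Ĉ(k)ⁿ dk/(2π)^d` of the symmetrised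
exponential `D̂^{(x)}` ([FvdH17-NoBLE] (3.34); tree: `srwTwist`) is the object every weighted slice
of the `K`, `U`, `KM₂` functionals of (3.36)–(3.38) is priced through (the `SrwTwist*` modules). The
multinomial reduction `Tw^{D̂^l}_n = d^{-l} Σ_{p : Fin l → Fin d} Tw^{Π_μ cos^{a_μ(p)}}_n` writes such a
slice as a sum of PRODUCT COSINE-POWER twisted seeds indexed by maps `p`, i.e. by exponent vectors
`a : Fin d → ℕ` with `Σ_μ a_μ = l` counted with multinomial multiplicity. This module records the two
symmetries that make the list of DISTINCT seeds short, with tree theorems only: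

* **k-side** (`DhatSym_comp_perm`): `D̂^{(x)}(k ∘ σ) = D̂^{(x)}(k)` for every coordinate permutation
  `σ` — the hyperoctahedral average (3.34) is reindexed by `(ν, δ) ↦ (νσ⁻¹, δ∘σ⁻¹)`; also
  `Dhat_comp_perm`, `Chat_comp_perm`. With the permutation invariance of the cube measure
  (`integral_comp_perm_P`, Mathlib's `measurePreserving_piCongrLeft`):
  **`srwTwist_weight_comp_perm : Tw^{w∘(·∘σ)}_n(x;β) = Tw^{w}_n(x;β)`**, `srwSqMom_weight_comp_perm`, and
  **`srwTwist_prodCosPow_comp_perm : Tw^{Π_μ cos^{a(σ μ)}}_n(x;β) = Tw^{Π_μ cos^{a_μ}}_n(x;β)`** — a product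
  cosine-power twisted seed depends on the exponent vector only through its multiset of values
  (its partition shape), at every node `x` and every `β`.
* **node side** (`srwTwist_spAct`, `srwSqMom_spAct`): `Tw^w_n(σ·x;β) = Tw^w_n(x;β)` for signed
  permutations `σ ∈ W_d` (from the tree's `DhatSym_spAct`).
* **grouping by composition type** (`Dhat_pow_eq_sum_piAntidiag`, Mathlib's multinomial theorem over
  `Finset.piAntidiag`): `D̂(k)^l = d^{-l} Σ_{a ∈ piAntidiag univ l} multinomial(a) Π_μ cos(k_μ)^{a_μ}` and
  **`srwTwist_Dhat_pow_eq_sum_piAntidiag (hd : 2n+1 ≤ d)`**: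
  `Tw^{D̂^l}_n(x;β) = d^{-l} Σ_{a ∈ piAntidiag univ l} multinomial(a) · Tw^{Π_μ cos^{a_μ}}_n(x;β)`;
  by `srwTwist_prodCosPow_comp_perm` the seeds in this sum are constant on permutation classes of `a`.

Sources: Fitzner–van der Hofstad, *Generalized approach to the non-backtracking lace expansion*,
PTRF 169 (2017), arXiv:1506.07969 — Def. 2.5 p. 1058 (signed permutations), (3.34)–(3.38) p. 1071,
§5.1.1 (5.2)–(5.5), §5.2 (5.9) p. 1092 (the SRW-integral functionals and their numerical evaluation).
What is reproduced: elementary symmetry bookkeeping of those integrals (no analytic content).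
-/

namespace Literature.Probability.FitznerVanDerHofstad2017

open MeasureTheory Finset Real
open Literature.Barriers.CriticalPhenomena
open Literature.Barriers.CriticalPhenomena.Slade2006Prop53 (P μI)

variable {d : ℕ}

/-! ### Coordinate permutations on the `k`-side -/

/-- `D̂(k ∘ σ) = D̂(k)`. [cite: FitznerVanDerHofstad2016NoBLE, (3.34) p. 1071] -/
theorem Dhat_comp_perm (σ : Equiv.Perm (Fin d)) (k : Fin d → ℝ) : Dhat d (k ∘ σ) = Dhat d k := by
  simp only [Dhat, Function.comp_apply]
  rw [Equiv.sum_comp σ (fun j => Real.cos (k j))]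

/-- `Ĉ_λ(k ∘ σ) = Ĉ_λ(k)`. [cite: FitznerVanDerHofstad2016NoBLE, (3.35) p. 1071] -/
theorem Chat_comp_perm (σ : Equiv.Perm (Fin d)) (lam : ℝ) (k : Fin d → ℝ) :
    Chat d lam (k ∘ σ) = Chat d lam k := by
  rw [Chat, Chat, Dhat_comp_perm]

/-- The phase `k·p(x;ν,δ)` at a permuted momentum is the phase at `k` of the reindexed signed
permutation `(νσ⁻¹, δ∘σ⁻¹) = spMul (σ⁻¹, 1) (ν, δ)` (`σ⁻¹ = σ.symm`). [cite: FitznerVanDerHofstad2016NoBLE, Def. 2.5 p. 1058] -/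
theorem phase_comp_perm (x : Fin d → ℤ) (k : Fin d → ℝ) (σ : Equiv.Perm (Fin d))
    (ρ : SgnPermPair d) : phase x (k ∘ σ) ρ = phase x k (spMul (σ.symm, 1) ρ) := by
  simp only [phase, spMul, Function.comp_apply, Pi.one_apply, one_mul, Equiv.Perm.mul_apply]
  rw [← Equiv.sum_comp σ (fun i => (((ρ.2 (σ.symm i) : ℤ) : ℝ) * (x (ρ.1 (σ.symm i)) : ℝ)) * k i)]
  simp only [Equiv.symm_apply_apply]

/-- **`D̂^{(x)}(k ∘ σ) = D̂^{(x)}(k)`**: the symmetrised exponential is invariant under coordinate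
permutations of the momentum. [cite: FitznerVanDerHofstad2016NoBLE, (3.34) p. 1071] -/
theorem DhatSym_comp_perm (σ : Equiv.Perm (Fin d)) (x : Fin d → ℤ) (k : Fin d → ℝ) :
    DhatSym d x (k ∘ σ) = DhatSym d x k := by
  rw [DhatSym_eq_sum_pairs, DhatSym_eq_sum_pairs]
  congr 1
  simp_rw [phase_comp_perm x k σ]
  exact (spMul_bijective ((σ.symm, 1) : SgnPermPair d)).sum_comp (fun ρ => Real.cos (phase x k ρ))

/-- The coordinate permutation `k ↦ k ∘ σ` preserves the cube measure `P_d = μI^{⊗ d}` (the symmetry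
behind the coordinate bookkeeping of the SRW integrals). [cite: FitznerVanDerHofstad2016NoBLE, §5.1.1 (5.2)–(5.5)] -/
theorem measurePreserving_comp_perm_P (σ : Equiv.Perm (Fin d)) :
    MeasurePreserving (fun k : Fin d → ℝ => k ∘ σ) (P d) (P d) := by
  have h := measurePreserving_piCongrLeft (fun _ : Fin d => μI) σ.symm
  have happ : ⇑(MeasurableEquiv.piCongrLeft (fun _ : Fin d => ℝ) σ.symm) = fun k => k ∘ σ := by
    funext k i
    simp [MeasurableEquiv.piCongrLeft, Equiv.piCongrLeft_apply_eq_cast]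
  rw [← happ]
  exact h

/-- Change of variables `k ↦ k ∘ σ` in a cube integral `∫ F dP_d`.
[cite: FitznerVanDerHofstad2016NoBLE, §5.1.1 (5.2)–(5.5)] -/
theorem integral_comp_perm_P {E : Type*} [NormedAddCommGroup E] [NormedSpace ℝ E]
    (σ : Equiv.Perm (Fin d)) (F : (Fin d → ℝ) → E) :
    ∫ k, F (k ∘ σ) ∂P d = ∫ k, F k ∂P d := by
  have h := measurePreserving_piCongrLeft (fun _ : Fin d => μI) σ.symm
  have happ : ∀ k, (MeasurableEquiv.piCongrLeft (fun _ : Fin d => ℝ) σ.symm) k = k ∘ σ := by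
    intro k
    funext i
    simp [MeasurableEquiv.piCongrLeft, Equiv.piCongrLeft_apply_eq_cast]
  have h2 := h.integral_comp' F
  simp_rw [happ] at h2
  exact h2

/-! ### Twisted moments: weight side and node side -/

/-- **`Tw^{w∘(·∘σ)}_n(x;β) = Tw^{w}_n(x;β)`**: a coordinate permutation of the weight does not change
the twisted moment. [cite: FitznerVanDerHofstad2016NoBLE, (3.34)–(3.36) p. 1071] -/
theorem srwTwist_weight_comp_perm {n : ℕ} (σ : Equiv.Perm (Fin d)) (w : (Fin d → ℝ) → ℝ)
    (x : Fin d → ℤ) (β : ℝ) :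
    srwTwist d n (fun k => w (k ∘ σ)) x β = srwTwist d n w x β := by
  unfold srwTwist
  congr 1
  have h := integral_comp_perm_P σ (fun k => (w k * Real.cos (β * DhatSym d x k)) * Chat d 1 k ^ n)
  simp only [DhatSym_comp_perm, Chat_comp_perm] at h
  exact h

/-- `Sq^{w∘(·∘σ)}_n(x) = Sq^{w}_n(x)`. [cite: FitznerVanDerHofstad2016NoBLE, (3.34) p. 1071; (5.7) p. 1091] -/
theorem srwSqMom_weight_comp_perm {n : ℕ} (σ : Equiv.Perm (Fin d)) (w : (Fin d → ℝ) → ℝ)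
    (x : Fin d → ℤ) :
    srwSqMom d n (fun k => w (k ∘ σ)) x = srwSqMom d n w x := by
  unfold srwSqMom
  congr 1
  have h := integral_comp_perm_P σ (fun k => (w k * DhatSym d x k ^ 2) * Chat d 1 k ^ n)
  simp only [DhatSym_comp_perm, Chat_comp_perm] at h
  exact h

/-- **Node side**: `Tw^w_n(σ·x;β) = Tw^w_n(x;β)` for every signed permutation `σ ∈ W_d`.
[cite: FitznerVanDerHofstad2016NoBLE, Def. 2.5 p. 1058; (3.34) p. 1071] -/
theorem srwTwist_spAct {n : ℕ} (w : (Fin d → ℝ) → ℝ) (τ : SgnPermPair d) (x : Fin d → ℤ) (β : ℝ) :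
    srwTwist d n w (spAct τ x) β = srwTwist d n w x β := by
  unfold srwTwist
  simp_rw [DhatSym_spAct]

/-- `Sq^w_n(σ·x) = Sq^w_n(x)` for every signed permutation `σ ∈ W_d`.
[cite: FitznerVanDerHofstad2016NoBLE, Def. 2.5 p. 1058; (5.7) p. 1091] -/
theorem srwSqMom_spAct {n : ℕ} (w : (Fin d → ℝ) → ℝ) (τ : SgnPermPair d) (x : Fin d → ℤ) :
    srwSqMom d n w (spAct τ x) = srwSqMom d n w x := by
  unfold srwSqMom
  simp_rw [DhatSym_spAct]

/-! ### Product cosine-power weights -/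

/-- Reindexing a product cosine-power weight: `Π_μ cos(k_{σμ})^{a_{σμ}} = Π_μ cos(k_μ)^{a_μ}`.
[cite: FitznerVanDerHofstad2016NoBLE, §5.1.1 (5.2)–(5.5)] -/
theorem prod_cos_pow_comp_perm (σ : Equiv.Perm (Fin d)) (a : Fin d → ℕ) (k : Fin d → ℝ) :
    ∏ μ, Real.cos ((k ∘ σ) μ) ^ a (σ μ) = ∏ μ, Real.cos (k μ) ^ a μ :=
  Equiv.prod_comp σ (fun ν => Real.cos (k ν) ^ a ν)

/-- **A product cosine-power twisted seed depends on the exponent vector only through its multiset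
of values**: `Tw^{Π_μ cos^{a(σμ)}}_n(x;β) = Tw^{Π_μ cos^{a_μ}}_n(x;β)` for every coordinate permutation `σ`,
every node `x` and every `β`. [cite: FitznerVanDerHofstad2016NoBLE, (3.34)–(3.36) p. 1071; §5.1.1 (5.2)–(5.5)] -/
theorem srwTwist_prodCosPow_comp_perm {n : ℕ} (σ : Equiv.Perm (Fin d)) (a : Fin d → ℕ)
    (x : Fin d → ℤ) (β : ℝ) :
    srwTwist d n (fun k => ∏ μ, Real.cos (k μ) ^ a (σ μ)) x β
      = srwTwist d n (fun k => ∏ μ, Real.cos (k μ) ^ a μ) x β := by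
  rw [← srwTwist_weight_comp_perm σ.symm (fun k => ∏ μ, Real.cos (k μ) ^ a μ) x β]
  congr 1
  funext k
  calc ∏ μ, Real.cos (k μ) ^ a (σ μ)
      = ∏ ν, (fun μ => Real.cos ((k ∘ σ.symm) μ) ^ a μ) (σ ν) := by
        simp only [Function.comp_apply, Equiv.symm_apply_apply]
    _ = ∏ μ, Real.cos ((k ∘ σ.symm) μ) ^ a μ :=
        Equiv.prod_comp σ (fun μ => Real.cos ((k ∘ σ.symm) μ) ^ a μ)

/-- `Sq`-side companion: `Sq^{Π_μ cos^{a(σμ)}}_n(x) = Sq^{Π_μ cos^{a_μ}}_n(x)`.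
[cite: FitznerVanDerHofstad2016NoBLE, (3.34) p. 1071; (5.7) p. 1091] -/
theorem srwSqMom_prodCosPow_comp_perm {n : ℕ} (σ : Equiv.Perm (Fin d)) (a : Fin d → ℕ)
    (x : Fin d → ℤ) :
    srwSqMom d n (fun k => ∏ μ, Real.cos (k μ) ^ a (σ μ)) x
      = srwSqMom d n (fun k => ∏ μ, Real.cos (k μ) ^ a μ) x := by
  rw [← srwSqMom_weight_comp_perm σ.symm (fun k => ∏ μ, Real.cos (k μ) ^ a μ) x]
  congr 1
  funext k
  calc ∏ μ, Real.cos (k μ) ^ a (σ μ)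
      = ∏ ν, (fun μ => Real.cos ((k ∘ σ.symm) μ) ^ a μ) (σ ν) := by
        simp only [Function.comp_apply, Equiv.symm_apply_apply]
    _ = ∏ μ, Real.cos ((k ∘ σ.symm) μ) ^ a μ :=
        Equiv.prod_comp σ (fun μ => Real.cos ((k ∘ σ.symm) μ) ^ a μ)

/-- Exponent vectors with the same multiset of values (`List.ofFn a ~ List.ofFn b`, a decidable
condition) have the same sorted form `a ∘ Tuple.sort a` (Mathlib's `Tuple.sort`).
[cite: FitznerVanDerHofstad2016NoBLE, §5.1.1 (5.2)–(5.5)] -/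
theorem comp_sort_eq_comp_sort_of_ofFn_perm (a b : Fin d → ℕ) (h : (List.ofFn a).Perm (List.ofFn b)) :
    a ∘ Tuple.sort a = b ∘ Tuple.sort b :=
  List.ofFn_injective <|
    List.Perm.eq_of_sortedLE (Tuple.monotone_sort a).sortedLE_ofFn
      (Tuple.monotone_sort b).sortedLE_ofFn
      ((((Tuple.sort a).ofFn_comp_perm a).trans h).trans ((Tuple.sort b).ofFn_comp_perm b).symm)

-- The rearrangement hypothesis is kernel-decidable (smoke instance on `Fin 3`):
example : (List.ofFn ![2, 0, 1]).Perm (List.ofFn ![0, 1, 2]) := by decide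

/-- **Equal value multisets ⇒ equal seeds**: if the exponent vectors `a`, `b` are rearrangements of
each other (`List.ofFn a ~ List.ofFn b`, decidable), then `Tw^{Π_μ cos^{a_μ}}_n(x;β) = Tw^{Π_μ cos^{b_μ}}_n(x;β)`
— one seed per partition shape. [cite: FitznerVanDerHofstad2016NoBLE, (3.34)–(3.36) p. 1071; §5.1.1 (5.2)–(5.5)] -/
theorem srwTwist_prodCosPow_eq_of_ofFn_perm {n : ℕ} (a b : Fin d → ℕ) (h : (List.ofFn a).Perm (List.ofFn b))
    (x : Fin d → ℤ) (β : ℝ) :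
    srwTwist d n (fun k => ∏ μ, Real.cos (k μ) ^ a μ) x β
      = srwTwist d n (fun k => ∏ μ, Real.cos (k μ) ^ b μ) x β := by
  rw [← srwTwist_prodCosPow_comp_perm (Tuple.sort a) a x β,
    ← srwTwist_prodCosPow_comp_perm (Tuple.sort b) b x β]
  have hs : ∀ μ, a (Tuple.sort a μ) = b (Tuple.sort b μ) :=
    fun μ => congrFun (comp_sort_eq_comp_sort_of_ofFn_perm a b h) μ
  simp_rw [hs]

/-- `Sq`-side companion of `srwTwist_prodCosPow_eq_of_ofFn_perm`.
[cite: FitznerVanDerHofstad2016NoBLE, (3.34) p. 1071; (5.7) p. 1091] -/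
theorem srwSqMom_prodCosPow_eq_of_ofFn_perm {n : ℕ} (a b : Fin d → ℕ) (h : (List.ofFn a).Perm (List.ofFn b))
    (x : Fin d → ℤ) :
    srwSqMom d n (fun k => ∏ μ, Real.cos (k μ) ^ a μ) x
      = srwSqMom d n (fun k => ∏ μ, Real.cos (k μ) ^ b μ) x := by
  rw [← srwSqMom_prodCosPow_comp_perm (Tuple.sort a) a x,
    ← srwSqMom_prodCosPow_comp_perm (Tuple.sort b) b x]
  have hs : ∀ μ, a (Tuple.sort a μ) = b (Tuple.sort b μ) :=
    fun μ => congrFun (comp_sort_eq_comp_sort_of_ofFn_perm a b h) μ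
  simp_rw [hs]

/-! ### Grouping the multinomial reduction of `D̂^l` by composition type -/

/-- **Multinomial theorem for `D̂^l`, grouped by exponent vector**:
`D̂(k)^l = d^{-l} Σ_{a ∈ piAntidiag univ l} multinomial(a) Π_μ cos(k_μ)^{a_μ}`, the sum running over the
compositions `a : Fin d → ℕ`, `Σ_μ a_μ = l`. [cite: FitznerVanDerHofstad2016NoBLE, §5.1.1 (5.2)–(5.5)] -/
theorem Dhat_pow_eq_sum_piAntidiag (l : ℕ) (k : Fin d → ℝ) :
    Dhat d k ^ l = ((d : ℝ) ^ l)⁻¹ * ∑ a ∈ (univ : Finset (Fin d)).piAntidiag l,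
      (Nat.multinomial univ a : ℝ) * ∏ μ, Real.cos (k μ) ^ a μ := by
  rw [Dhat, div_pow, Finset.sum_pow_eq_sum_piAntidiag, div_eq_inv_mul]

/-- Product cosine-power weights are measurable (plumbing). [folklore] -/
private theorem measurable_prod_cos_pow' (a : Fin d → ℕ) :
    Measurable (fun k : Fin d → ℝ => ∏ μ, Real.cos (k μ) ^ a μ) := by
  fun_prop

/-- Product cosine-power weights are bounded by `1` (plumbing). [folklore] -/
private theorem abs_prod_cos_pow_le_one' (a : Fin d → ℕ) (k : Fin d → ℝ) :
    |∏ μ, Real.cos (k μ) ^ a μ| ≤ 1 := by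
  rw [Finset.abs_prod]
  exact Finset.prod_le_one (fun _ _ => abs_nonneg _) fun μ _ => by
    rw [abs_pow]
    exact pow_le_one₀ (abs_nonneg _) (abs_cos_le_one _)

/-- `Tw` is homogeneous in the weight (plumbing; the public version lives with the cos-power rows). [folklore] -/
private theorem srwTwist_const_mul_weight' {n : ℕ} (c : ℝ) (w : (Fin d → ℝ) → ℝ) (x : Fin d → ℤ)
    (β : ℝ) : srwTwist d n (fun k => c * w k) x β = c * srwTwist d n w x β := by
  unfold srwTwist
  have hptw : (fun k : Fin d → ℝ => ((c * w k) * Real.cos (β * DhatSym d x k)) * Chat d 1 k ^ n)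
      = fun k => c * ((w k * Real.cos (β * DhatSym d x k)) * Chat d 1 k ^ n) := by
    funext k
    ring
  rw [hptw, integral_const_mul, mul_div_assoc]

/-- **`D̂^l`-weighted twisted moments as a composition-indexed combination of product cosine-power
seeds**: for `d ≥ 2n + 1`,
`Tw^{D̂^l}_n(x;β) = d^{-l} Σ_{a ∈ piAntidiag univ l} multinomial(a) · Tw^{Π_μ cos^{a_μ}}_n(x;β)`; by
`srwTwist_prodCosPow_comp_perm` the seeds are constant on coordinate-permutation classes of `a`.
[cite: FitznerVanDerHofstad2016NoBLE, (3.34)–(3.36) p. 1071; §5.1.1 (5.2)–(5.5); §5.2 (5.9) p. 1092] -/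
theorem srwTwist_Dhat_pow_eq_sum_piAntidiag {n : ℕ} (hd : 2 * n + 1 ≤ d) (x : Fin d → ℤ) (β : ℝ)
    (l : ℕ) :
    srwTwist d n (fun k => Dhat d k ^ l) x β = ((d : ℝ) ^ l)⁻¹ *
      ∑ a ∈ (univ : Finset (Fin d)).piAntidiag l,
        (Nat.multinomial univ a : ℝ) * srwTwist d n (fun k => ∏ μ, Real.cos (k μ) ^ a μ) x β := by
  have hw : (fun k : Fin d → ℝ => Dhat d k ^ l) = fun k => ((d : ℝ) ^ l)⁻¹ *
      ∑ a ∈ (univ : Finset (Fin d)).piAntidiag l,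
        (Nat.multinomial univ a : ℝ) * ∏ μ, Real.cos (k μ) ^ a μ :=
    funext (Dhat_pow_eq_sum_piAntidiag l)
  rw [hw, srwTwist_const_mul_weight',
    srwTwist_sum_weight _ (fun a => (Nat.multinomial univ a : ℝ))
      (fun a k => ∏ μ, Real.cos (k μ) ^ a μ) hd (fun a _ => measurable_prod_cos_pow' a)
      (fun a _ => ⟨1, abs_prod_cos_pow_le_one' a⟩) x β]

/-- `Sq`-side companion: `Sq^{D̂^l}_n(x) = d^{-l} Σ_{a ∈ piAntidiag univ l} multinomial(a) · Sq^{Π_μ cos^{a_μ}}_n(x)`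
pointwise in the weight (no integrability hypothesis is needed for the pointwise identity of weights;
the integral identity is stated for `d ≥ 2n + 1`). [cite: FitznerVanDerHofstad2016NoBLE, (3.34) p. 1071; (5.7) p. 1091] -/
theorem Dhat_pow_mul_eq_sum_piAntidiag_mul (l : ℕ) (k : Fin d → ℝ) (g : ℝ) :
    Dhat d k ^ l * g = ((d : ℝ) ^ l)⁻¹ * ∑ a ∈ (univ : Finset (Fin d)).piAntidiag l,
      (Nat.multinomial univ a : ℝ) * ((∏ μ, Real.cos (k μ) ^ a μ) * g) := by
  rw [Dhat_pow_eq_sum_piAntidiag, mul_assoc, Finset.sum_mul]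
  refine congrArg _ (Finset.sum_congr rfl fun a _ => ?_)
  ring

end Literature.Probability.FitznerVanDerHofstad2017
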